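import Mathlib
import HarnessLib
import Summits.Ventures.LatticeQCDFlow.Exactness.GaussianQuadraticSecondMoment

/-!
# The links are independent under the engine's refresh law: product expectations, and `Var(−Σ_l tr P_l²) = |L|·(N²−1)/2`

HONEST FRAMING: exact (Metropolis-corrected) sampling algorithms for lattice gauge theory;
figures of merit are autocorrelation/cost numbers at stated couplings and volumes; no
continuum-physics claim.

Venture `LatticeQCDFlow` (cell pub-lqcd), topic `Exactness`, FANOUT row 14 (eng-flowhmc; the `SU(N)`
momentum heat-bath of the engine: refresh law `Z⁻¹e^{−Σ_l q(p_l)}dμ^{⊗L}` on `L → SUNCoords N`,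
`q = sunCoordQuad N = −tr P²`).  NEW WORK of the cell over `GaussianQuadraticEquipartition` /
`GaussianQuadraticSecondMoment` (`E q(p_l) = D/2`, `E q(p_l)² = (D/2)(D/2+1)`, `D + 1 = N²`) and
`SUNEngineMomentumMoments` (one-link Tonelli); nothing here is cited as a fact.

* §1 **product expectations factorise** (Tonelli over the links for the product density): for one-link
  observables `φ_m ≥ 0` with `φ_m e^{−q}` integrable,
  `∫⁻ ∏_m φ_m(p_m) d(e^{−T}μ^{⊗L}) = ∏_m ∫ φ_m e^{−q} dμ` (`lintegral_prod_apply_sunMomentumWeight_sunKinetic`)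
  and **`E ∏_m φ_m(p_m) = ∏_m (∫ φ_m e^{−q} dμ)/(∫ e^{−q} dμ)`** (`integral_prod_apply_sunMomentumLaw_sunKinetic`)
  — the links are independent under the heat-bath;
* §2 **`E q(p_l)·q(p_l') = (D/2)²` for `l ≠ l'`** (`integral_sunCoordQuad_mul_apply_sunKineticLaw`),
  **`E T² = |L|²(D/2)² + |L|·D/2`** and **`Var T = E(T − |L|·D/2)² = |L|·D/2`** for the total kinetic
  energy `T = sunKinetic N p = −Σ_l tr P_l²` (`variance_sunKinetic_sunKineticLaw`); with `D = N² − 1`: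
  **`Var T = |L|·(N² − 1)/2`** (`variance_sunKinetic_sunKineticLaw_eq`) — mean AND error bar of the
  `⟨K⟩ = #dof/2` heat-bath check, exactly.

NOT CLAIMED: the full law of `T` (a `½χ²_{|L|(N²−1)}` variable) beyond its first two moments; anything
numerical; floating point.
-/

noncomputable section
namespace Summit.Ventures.LatticeQCDFlow.Exactness

open Set MeasureTheory Filter Topology
open scoped ENNReal

section Product
variable (N : ℕ) (μ : Measure (SUNCoords N)) [μ.IsAddHaarMeasure] {L : Type*} [Fintype L]

/-! ## §1 Product expectations factorise over the links -/

/-- **Tonelli for a product of one-link observables against the product density**: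
`∫⁻ ∏_m φ_m(p_m) · e^{−T(p)} dμ^{⊗L} = ∏_m ∫ φ_m e^{−q} dμ` (`φ_m ≥ 0`, `φ_m e^{−q}` integrable). -/
theorem lintegral_prod_apply_sunMomentumWeight_sunKinetic {φ : L → SUNCoords N → ℝ} (hφ0 : ∀ m c, 0 ≤ φ m c)
    (hφm : ∀ m, Measurable (φ m)) (hφi : ∀ m, Integrable (fun c => φ m c * Real.exp (-sunCoordQuad N c)) μ) :
    ∫⁻ p, ENNReal.ofReal (∏ m, φ m (p m)) ∂(sunMomentumWeight (L := L) μ (sunKinetic N)) =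
      ∏ m, ENNReal.ofReal (∫ c, φ m c * Real.exp (-sunCoordQuad N c) ∂μ) := by
  set F : L → SUNCoords N → ℝ≥0∞ := fun m c => ENNReal.ofReal (φ m c * Real.exp (-sunCoordQuad N c)) with hF
  have hFm : ∀ m, Measurable (F m) := fun m =>
    ((hφm m).mul (Real.measurable_exp.comp (continuous_sunCoordQuad N).measurable.neg)).ennreal_ofReal
  have hdens : ∀ p : L → SUNCoords N,
      ENNReal.ofReal (Real.exp (-sunKinetic N p)) * ENNReal.ofReal (∏ m, φ m (p m)) = ∏ m, F m (p m) := by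
    intro p
    rw [← ENNReal.ofReal_mul (Real.exp_pos _).le, mul_comm, sunKinetic, ← Finset.sum_neg_distrib, Real.exp_sum,
      ← Finset.prod_mul_distrib, ENNReal.ofReal_prod_of_nonneg fun m _ => mul_nonneg (hφ0 m _) (Real.exp_pos _).le]
  have hmd : Measurable (fun p : L → SUNCoords N => ENNReal.ofReal (Real.exp (-sunKinetic N p))) :=
    (Real.measurable_exp.comp (measurable_sunKinetic N).neg).ennreal_ofReal
  have hmφ : Measurable (fun p : L → SUNCoords N => ENNReal.ofReal (∏ m, φ m (p m))) :=
    (Finset.measurable_prod _ fun m _ => (hφm m).comp (measurable_pi_apply m)).ennreal_ofReal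
  rw [sunMomentumWeight, lintegral_withDensity_eq_lintegral_mul _ hmd hmφ]
  have hfun : ((fun p : L → SUNCoords N => ENNReal.ofReal (Real.exp (-sunKinetic N p))) *
      fun p => ENNReal.ofReal (∏ m, φ m (p m))) = fun p => ∏ m, F m (p m) := funext hdens
  rw [hfun, lintegral_prod_pi (fun _ : L => μ) hFm]
  refine Finset.prod_congr rfl fun m _ => ?_
  rw [hF, ← ofReal_integral_eq_lintegral_ofReal (hφi m)
    (Eventually.of_forall fun c => mul_nonneg (hφ0 m c) (Real.exp_pos _).le)]

/-- **THE LINKS ARE INDEPENDENT UNDER THE HEAT-BATH**: `E ∏_m φ_m(p_m) = ∏_m (∫ φ_m e^{−q} dμ)/(∫ e^{−q} dμ)`. -/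
theorem integral_prod_apply_sunMomentumLaw_sunKinetic {φ : L → SUNCoords N → ℝ} (hφ0 : ∀ m c, 0 ≤ φ m c)
    (hφm : ∀ m, Measurable (φ m)) (hφi : ∀ m, Integrable (fun c => φ m c * Real.exp (-sunCoordQuad N c)) μ) :
    ∫ p, ∏ m, φ m (p m) ∂(sunMomentumLaw (L := L) μ (sunKinetic N)) =
      ∏ m, (∫ c, φ m c * Real.exp (-sunCoordQuad N c) ∂μ) / ∫ c, Real.exp (-sunCoordQuad N c) ∂μ := by
  have hJ0 := integral_exp_neg_sunCoordQuad_pos N μ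
  have hJk : ∀ m, 0 ≤ ∫ c, φ m c * Real.exp (-sunCoordQuad N c) ∂μ := fun m =>
    integral_nonneg fun c => mul_nonneg (hφ0 m c) (Real.exp_pos _).le
  have hmeas : Measurable fun p : L → SUNCoords N => ∏ m, φ m (p m) :=
    Finset.measurable_prod _ fun m _ => (hφm m).comp (measurable_pi_apply m)
  rw [integral_eq_lintegral_of_nonneg_ae (Eventually.of_forall fun p => Finset.prod_nonneg fun m _ => hφ0 m _)
    hmeas.aestronglyMeasurable, sunMomentumLaw, lintegral_smul_measure,
    lintegral_prod_apply_sunMomentumWeight_sunKinetic N μ hφ0 hφm hφi, sunMomentumWeight_sunKinetic_univ N μ, smul_eq_mul,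
    ENNReal.toReal_mul, ENNReal.toReal_inv, ENNReal.toReal_pow, ENNReal.toReal_prod, ENNReal.toReal_ofReal hJ0.le]
  simp_rw [ENNReal.toReal_ofReal (hJk _)]
  rw [Finset.prod_div_distrib, Finset.prod_const, Finset.card_univ, div_eq_inv_mul]

/-! ## §2 Two-link expectations and the variance of the total kinetic energy -/

/-- **`E q(p_l)·q(p_l') = (D/2)²` for distinct links** (independence + equipartition). -/
theorem integral_sunCoordQuad_mul_apply_sunKineticLaw {l l' : L} (hll' : l ≠ l') :
    ∫ p, sunCoordQuad N (p l) * sunCoordQuad N (p l') ∂(sunMomentumLaw (L := L) μ (sunKinetic N)) =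
      ((Module.finrank ℝ (SUNCoords N) : ℝ) / 2) ^ 2 := by
  classical
  set φ : L → SUNCoords N → ℝ := fun m c => if m = l ∨ m = l' then sunCoordQuad N c else 1 with hφ
  have hφ0 : ∀ m c, 0 ≤ φ m c := fun m c => by
    by_cases h : m = l ∨ m = l'
    · simp only [hφ, h, if_true]; exact sunCoordQuad_nonneg N c
    · simp only [hφ, h, if_false]; exact zero_le_one
  have hφm : ∀ m, Measurable (φ m) := fun m => by
    by_cases h : m = l ∨ m = l'
    · simp only [hφ, h, if_true]; exact (continuous_sunCoordQuad N).measurable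
    · simp only [hφ, h, if_false]; exact measurable_const
  have hφi : ∀ m, Integrable (fun c => φ m c * Real.exp (-sunCoordQuad N c)) μ := fun m => by
    by_cases h : m = l ∨ m = l'
    · simp only [hφ, h, if_true]; exact integrable_sunCoordQuad_mul_exp_neg N μ
    · simp only [hφ, h, if_false, one_mul]; exact integrable_exp_neg_sunCoordQuad N μ
  -- the product over the links is `q(p_l)·q(p_l')`
  have hprod : ∀ p : L → SUNCoords N, ∏ m, φ m (p m) = sunCoordQuad N (p l) * sunCoordQuad N (p l') := by
    intro p
    rw [← Finset.mul_prod_erase Finset.univ (fun m => φ m (p m)) (Finset.mem_univ l),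
      ← Finset.mul_prod_erase (Finset.univ.erase l) (fun m => φ m (p m))
        (Finset.mem_erase.2 ⟨hll'.symm, Finset.mem_univ l'⟩)]
    have hl : φ l (p l) = sunCoordQuad N (p l) := by simp only [hφ, true_or, if_true]
    have hl' : φ l' (p l') = sunCoordQuad N (p l') := by simp only [hφ, or_true, if_true]
    have hrest : ∏ m ∈ (Finset.univ.erase l).erase l', φ m (p m) = 1 := by
      refine Finset.prod_eq_one fun m hm => ?_
      have h1 : m ≠ l' := Finset.ne_of_mem_erase hm
      have h2 : m ≠ l := Finset.ne_of_mem_erase (Finset.mem_of_mem_erase hm)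
      have h : ¬(m = l ∨ m = l') := not_or.2 ⟨h2, h1⟩
      simp only [hφ, h, if_false]
    rw [hl, hl', hrest, mul_one]
  have h := integral_prod_apply_sunMomentumLaw_sunKinetic N μ hφ0 hφm hφi
  simp_rw [hprod] at h
  rw [h]
  -- the product of the one-link ratios is `(J/Z₁)²`
  set Z₁ : ℝ := ∫ c, Real.exp (-sunCoordQuad N c) ∂μ with hZ₁
  have hZ0 : Z₁ ≠ 0 := (integral_exp_neg_sunCoordQuad_pos N μ).ne'
  have hJD : (∫ c, sunCoordQuad N c * Real.exp (-sunCoordQuad N c) ∂μ) / Z₁ = (Module.finrank ℝ (SUNCoords N) : ℝ) / 2 := by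
    rw [integral_sunCoordQuad_mul_exp_neg, hZ₁.symm, mul_div_assoc, div_self hZ0, mul_one]
  have hratio : ∀ m, (∫ c, φ m c * Real.exp (-sunCoordQuad N c) ∂μ) / Z₁ =
      if m = l ∨ m = l' then (Module.finrank ℝ (SUNCoords N) : ℝ) / 2 else 1 := by
    intro m
    by_cases h : m = l ∨ m = l'
    · simp only [hφ, h, if_true]; exact hJD
    · simp only [hφ, h, if_false, one_mul]; exact div_self hZ0
  rw [Finset.prod_congr rfl fun m _ => hratio m,
    ← Finset.mul_prod_erase Finset.univ _ (Finset.mem_univ l),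
    ← Finset.mul_prod_erase (Finset.univ.erase l) _ (Finset.mem_erase.2 ⟨hll'.symm, Finset.mem_univ l'⟩)]
  have hrest1 : ∏ m ∈ (Finset.univ.erase l).erase l',
      (if m = l ∨ m = l' then (Module.finrank ℝ (SUNCoords N) : ℝ) / 2 else 1) = 1 := by
    refine Finset.prod_eq_one fun m hm => ?_
    have h1 : m ≠ l' := Finset.ne_of_mem_erase hm
    have h2 : m ≠ l := Finset.ne_of_mem_erase (Finset.mem_of_mem_erase hm)
    rw [if_neg (not_or.2 ⟨h2, h1⟩)]
  rw [hrest1, if_pos (Or.inl rfl), if_pos (Or.inr rfl), mul_one, sq]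

/-- `q(p_l)·q(p_l')` is integrable under the refresh law (any two links). -/
theorem integrable_sunCoordQuad_mul_apply_sunKineticLaw (l l' : L) :
    Integrable (fun p : L → SUNCoords N => sunCoordQuad N (p l) * sunCoordQuad N (p l'))
      (sunMomentumLaw (L := L) μ (sunKinetic N)) := by
  -- `ab ≤ (a² + b²)/2`
  refine (((integrable_sunCoordQuad_sq_apply_sunKineticLaw N μ l).add
    (integrable_sunCoordQuad_sq_apply_sunKineticLaw N μ l')).div_const 2).mono'
    (((continuous_sunCoordQuad N).measurable.comp (measurable_pi_apply l)).mul
      ((continuous_sunCoordQuad N).measurable.comp (measurable_pi_apply l'))).aestronglyMeasurable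
    (Eventually.of_forall fun p => ?_)
  rw [Real.norm_eq_abs, abs_of_nonneg (mul_nonneg (sunCoordQuad_nonneg N _) (sunCoordQuad_nonneg N _))]
  have := sq_nonneg (sunCoordQuad N (p l) - sunCoordQuad N (p l'))
  have hexp : (sunCoordQuad N (p l) - sunCoordQuad N (p l')) ^ 2 =
      sunCoordQuad N (p l) ^ 2 + sunCoordQuad N (p l') ^ 2 - 2 * (sunCoordQuad N (p l) * sunCoordQuad N (p l')) := by ring
  simp only [Pi.add_apply] at *
  linarith

/-- **`E T² = |L|·D/2 + (|L|·D/2)²`** for the total kinetic energy `T = Σ_l q(p_l)`. -/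
theorem integral_sunKinetic_sq_sunKineticLaw :
    ∫ p, sunKinetic N p ^ 2 ∂(sunMomentumLaw (L := L) μ (sunKinetic N)) =
      Fintype.card L * ((Module.finrank ℝ (SUNCoords N) : ℝ) / 2) +
        (Fintype.card L * ((Module.finrank ℝ (SUNCoords N) : ℝ) / 2)) ^ 2 := by
  classical
  set ν := sunMomentumLaw (L := L) μ (sunKinetic N) with hν
  set a : ℝ := (Module.finrank ℝ (SUNCoords N) : ℝ) / 2 with ha
  -- expand the square as a double sum and integrate term by term
  have hsq : ∀ p : L → SUNCoords N, sunKinetic N p ^ 2 = ∑ l, ∑ l', sunCoordQuad N (p l) * sunCoordQuad N (p l') := by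
    intro p; rw [sunKinetic, sq, Finset.sum_mul_sum]
  simp_rw [hsq]
  rw [integral_finsetSum _ fun l _ => integrable_finsetSum _ fun l' _ => integrable_sunCoordQuad_mul_apply_sunKineticLaw N μ l l']
  have hinner : ∀ l : L, ∫ p, ∑ l', sunCoordQuad N (p l) * sunCoordQuad N (p l') ∂ν = a * (a + 1) + (Fintype.card L - 1) * a ^ 2 := by
    intro l
    rw [integral_finsetSum _ fun l' _ => integrable_sunCoordQuad_mul_apply_sunKineticLaw N μ l l',
      ← Finset.add_sum_erase _ _ (Finset.mem_univ l)]
    have hdiag : ∫ p, sunCoordQuad N (p l) * sunCoordQuad N (p l) ∂ν = a * (a + 1) := by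
      rw [ha, ← integral_sunCoordQuad_sq_apply_sunKineticLaw N μ (L := L) l]
      exact integral_congr_ae (Eventually.of_forall fun p => (sq _).symm)
    have hoff : ∑ l' ∈ Finset.univ.erase l, ∫ p, sunCoordQuad N (p l) * sunCoordQuad N (p l') ∂ν =
        ∑ _l' ∈ Finset.univ.erase l, a ^ 2 :=
      Finset.sum_congr rfl fun l' hl' => by
        rw [ha]; exact integral_sunCoordQuad_mul_apply_sunKineticLaw N μ (Finset.ne_of_mem_erase hl').symm
    rw [hdiag, hoff, Finset.sum_const, Finset.card_erase_of_mem (Finset.mem_univ l), Finset.card_univ, nsmul_eq_mul,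
      Nat.cast_sub (Fintype.card_pos_iff.2 ⟨l⟩), Nat.cast_one]
  rw [Finset.sum_congr rfl fun l _ => hinner l, Finset.sum_const, Finset.card_univ, nsmul_eq_mul]
  ring

/-- **`Var T = E(T − |L|·D/2)² = |L|·D/2`** — the error bar of the equipartition check, exactly. -/
theorem variance_sunKinetic_sunKineticLaw :
    ∫ p, (sunKinetic N p - Fintype.card L * ((Module.finrank ℝ (SUNCoords N) : ℝ) / 2)) ^ 2
        ∂(sunMomentumLaw (L := L) μ (sunKinetic N)) =
      Fintype.card L * ((Module.finrank ℝ (SUNCoords N) : ℝ) / 2) := by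
  set ν := sunMomentumLaw (L := L) μ (sunKinetic N) with hν
  haveI : IsProbabilityMeasure ν := isProbabilityMeasure_sunMomentumLaw_sunKinetic N μ
  set M : ℝ := Fintype.card L * ((Module.finrank ℝ (SUNCoords N) : ℝ) / 2) with hM
  have hi1 : Integrable (sunKinetic (L := L) N) ν :=
    integrable_finsetSum _ fun l _ => integrable_sunCoordQuad_apply_sunKineticLaw N μ l
  have hi2 : Integrable (fun p : L → SUNCoords N => sunKinetic N p ^ 2) ν := by
    have h : ∀ p : L → SUNCoords N, sunKinetic N p ^ 2 = ∑ l, ∑ l', sunCoordQuad N (p l) * sunCoordQuad N (p l') := by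
      intro p; rw [sunKinetic, sq, Finset.sum_mul_sum]
    simp_rw [h]
    exact integrable_finsetSum _ fun l _ => integrable_finsetSum _ fun l' _ =>
      integrable_sunCoordQuad_mul_apply_sunKineticLaw N μ l l'
  have hexp : ∀ p : L → SUNCoords N, (sunKinetic N p - M) ^ 2 = sunKinetic N p ^ 2 - 2 * M * sunKinetic N p + M ^ 2 := by
    intro p; ring
  simp_rw [hexp]
  have hMq : Integrable (fun p : L → SUNCoords N => 2 * M * sunKinetic N p) ν := hi1.const_mul _
  have hsub : Integrable (fun p : L → SUNCoords N => sunKinetic N p ^ 2 - 2 * M * sunKinetic N p) ν := hi2.sub hMq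
  rw [integral_add hsub (integrable_const _), integral_sub hi2 hMq, integral_const_mul, integral_const, smul_eq_mul,
    probReal_univ, one_mul, integral_sunKinetic_sq_sunKineticLaw, integral_sunKinetic_sunKineticLaw, ← hM]
  ring

/-- **With `D = N² − 1` written out** (`N ≥ 1`): `Var(−Σ_l tr P_l²) = |L|·(N² − 1)/2`. -/
theorem variance_sunKinetic_sunKineticLaw_eq (hN : 1 ≤ N) :
    ∫ p, (sunKinetic N p - Fintype.card L * (((N : ℝ) ^ 2 - 1) / 2)) ^ 2 ∂(sunMomentumLaw (L := L) μ (sunKinetic N)) =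
      Fintype.card L * (((N : ℝ) ^ 2 - 1) / 2) := by
  rw [← finrank_sunCoords_eq N hN]
  exact variance_sunKinetic_sunKineticLaw N μ
end Product

end Summit.Ventures.LatticeQCDFlow.Exactness
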